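import Summits.RiemannHypothesis.RiemannHypothesis.Theorems.NymanBeurlingNbThesis
import Literature.Barriers.RiemannHypothesis.BohrDenseValuesVoronin
import Literature.NumberTheory.LFunctions.GeneralizedRH
import Literature.NumberTheory.LFunctions.FiniteLSeries
import Literature.NumberTheory.LFunctions.ZetaFirstZeroCertificate
import Literature.NumberTheory.LFunctions.SaiasWeingartnerLeftProofs
import Literature.NumberTheory.LFunctions.HybridJointUniversalityProofs
import Mathlib.Analysis.Complex.CauchyIntegral
import Mathlib.Topology.MetricSpace.ProperSpace
import Mathlib.Topology.Sequences
import HarnessLib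

/-!
# One-shot (single-witness, sup-norm) Nyman–Beurling certificates are decided RH-free: refuted by
# MOLLIFIED UNIVERSALITY on every strip σ₀ < σ < 1, σ₀ < 1, and `ζ·A` attains every non-zero value
# far up every sub-strip (NB-NEG, census axis V42 «ONE-SHOT») — cell `rh-split`; raw quantified
# forms, ZERO defs; typed by rh-split-nb-neg g17

Family nb (Nyman–Beurling / Báez-Duarte), lens NEG, card
`run/shared/lean/pub/rh-split/cards/SPLIT-nb-neg.md` §23 (gen 17).  `E_NB = Theses.NymanBeurling.NbThesis`
(`∀ ε > 0, ∃ N a, ∫⁻ ‖1 - ζ(1/2+it)·A_a(1/2+it)‖² dt/(1/4+t²) < ε`,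
`A_a(s) = Σ_{n<N} a_n (n+1)^{-s}`), kernel `Theorems.nbThesis_iff_riemannHypothesis`.  V42 cuts the
QUANTIFIER/TOPOLOGY axis of `E_NB`: replace «for every ε some witness is ε-close in `L²(dt/(1/4+t²))`»
by a SINGLE WITNESS that is POINTWISE good on a strip, the one-shot certificate
`ONE-SHOT_θ(σ₀, T) := ∃ N a, ∀ s, σ₀ < Re s < 1 → Im s ≥ T → ‖1 - ζ(s)·A_a(s)‖ < θ`
(`θ = 1`, `T = -∞` is the basic one).

* §1 (Dirichlet polynomials; `ζ`-free, RH-free).  Uniqueness of Dirichlet coefficients on a disc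
  (`eq_zero_of_sum_range_eq_zero_on_ball`, `eq_zero_of_sum_eq_zero_on_ball`: identity theorem + Mathlib's
  injectivity of `L`-series) and the DISC FLOOR (`exists_disc_floor`): for `a ≠ 0` and any disc
  `|s - c| ≤ ρ` there is `m > 0` such that for EVERY unimodular twist `Θ` the polynomial
  `Σ a_n Θ_n (n+1)^{-s}` has modulus `≥ m` somewhere on the disc (compactness of the torus `(S¹)^N`);
  hence the WINDOW FLOOR (`exists_window_floor`, T43a): `|A_a| ≥ m` somewhere on every vertical
  translate `|s - (c+iτ)| ≤ ρ`, uniformly in `τ ∈ ℝ`.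
* §2 (MOLLIFIED UNIVERSALITY, elementary route = the disc universality theorem for `ζ` ALONE, landed as
  `Literature.NumberTheory.LFunctions.Steuding2007_thm1_9_discAnalytic_holds` (Voronin 1975; Steuding
  Thm. 1.9, disc case), run with CONSTANT targets, times the window floor).  For `1/2 < σ₁ < σ₂ < 1`,
  every `a ≠ 0`, every `R`, `δ > 0` and `T₀`: some `s` with `σ₁ ≤ Re s ≤ σ₂`, `Im s ≥ T₀` has
  `‖ζ(s)A_a(s)‖ > R` (`exists_lt_norm_zeta_mul`, T43b), some has `‖ζ(s)A_a(s)‖ < δ`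
  (`exists_norm_zeta_mul_lt`, T43c, any `a`), and some has `‖1 - ζ(s)A_a(s)‖ > R`
  (`exists_lt_norm_one_sub_zeta_mul`, T43b′): NO Dirichlet polynomial mollifies `ζ` uniformly on any
  far part of any closed sub-strip of `1/2 < σ < 1` — the Nyman–Beurling defect `1 - ζA` is UNBOUNDED
  there and `ζA` is confined to no annulus `δ ≤ |z| ≤ R`.
* §2′ (HYBRID UNIVERSALITY, sharp route = Pańkowski's hybrid joint universality theorem, landed as
  `Literature.NumberTheory.LFunctions.Pankowski2010_thm1_1_discAnalytic_holds`, for `ζ = L(·, 𝟙 mod 1)`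
  with the prime frequencies `-log p/2π` (tree `KroneckerWeyl.linearIndependent_neg_log_prime_div`),
  the target `(c + (s - σ₀))/A` and Rouché (tree `exists_zero_of_norm_sub_lt`) — the mechanism of
  Kaczorowski–Kulas 2007, Thm. 2 / Pańkowski 2010, Cor. 5.3, here with ONE character).  T43e
  `exists_zeta_mul_eq`: for `1/2 < σ₁ < σ₂ < 1`, `a ≠ 0`, EVERY `c ≠ 0` and every `T₀` some `s` with
  `σ₁ < Re s < σ₂`, `Im s ≥ T₀` has `ζ(s)A_a(s) = c` EXACTLY; hence the NB defect attains every value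
  `v ≠ 1` far up every sub-strip (`exists_one_sub_zeta_mul_eq`, T43e′) and there are PERFECT
  MOLLIFICATION POINTS `ζ(s)A_a(s) = 1` for every `a ≠ 0` (`exists_zeta_mul_eq_one`, T43e″).
* §3 (the census row V42).  K1 `qrh_of_oneShot` / `rh_of_oneShot` / `nbThesis_of_oneShot` /
  `zerosBelow_of_oneShotFar`: ONE-SHOT₁(σ₀) ⟹ `QuasiRiemannHypothesis σ₀` (no zero with
  `σ₀ < Re s < 1`: at a zero the defect is `‖1 - 0‖ = 1`), ONE-SHOT₁(1/2) ⟹ RH ⟹ `NbThesis` (symmetry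
  `s ↦ 1 - s`, tree `quasiRiemannHypothesis_one_half_iff_holds`; deep half of Báez-Duarte, tree
  `nbThesis_iff_riemannHypothesis`), and the far version confines the zeros of the strip below `T`.
  K2 `oneShotFar_iff_one_lt` / `oneShot_iff_one_lt`: for EVERY `σ₀ < 1`, every `T` and every `θ`,
  ONE-SHOT_θ(σ₀, T) ⟺ `θ > 1` — DECIDED RH-FREE (§2; `⇐` by the empty polynomial), so
  `not_oneShot` / `not_oneShotFar` / `not_oneShot_half`: the `θ = 1` certificates are all REFUTED — a
  pointwise single-witness certificate cannot certify any zero-free strip, however thin or far up.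
  Hence `oneShot_split_vacuous` (`_rh`): «ONE-SHOT ∧ B ⟹ QRH(σ₀)» (resp. `⟹ RH`) holds for EVERY `B`
  with a REFUTED first conjunct — bookkeeping, never a splitting.  K4 `not_oneShot_criticalLine`: the
  critical-line one-shot `∀ t, ‖1 - ζ(1/2+it)A(1/2+it)‖ < 1` (`E_NB`'s integrand, pointwise) is
  refuted by ONE certified critical zero (tree `exists_zero_Icc_first_bracket`,
  `γ₁ ∈ [225/16, 227/16]`): at a critical zero the NB defect equals `1` whatever the mollifier
  (`nbDefect_eq_one_of_zero`).

Every RH statement spells `_root_.RiemannHypothesis`.  No definitions.  Standard axioms only.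

HONEST LABEL: «SPLITTING SEARCH over kernel-typed RH-EQUIVALENCES; a splitting A ∧ B ⟹ RH is CONDITIONAL
bookkeeping unless A and B are both proved; nothing here bears on the truth of RH.»
-/

noncomputable section

-- D-0017: `Summit.<S>.<S>.…` is the designed namespace of a single-problem summit.
set_option linter.dupNamespace false

open Complex Filter Topology Metric LSeries

namespace Summit.RiemannHypothesis.RiemannHypothesis.Theorems.Splittings.NbOneShot

open Summit.RiemannHypothesis.RiemannHypothesis.Theses.NymanBeurling
open Summit.RiemannHypothesis.RiemannHypothesis.Theorems
open Literature.NumberTheory.LFunctions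
open Literature.Barriers.RiemannHypothesis

/-! ## §1 — Dirichlet polynomials: uniqueness on a disc, the disc floor, the window floor -/

/-- A Dirichlet polynomial `Σ_{m<N} c_m (m+1)^{-w}` is the `L`-series of the finitely supported
sequence `k ↦ c_{k-1}` (`1 ≤ k ≤ N`). [folklore] -/
theorem LSeries_shift_eq_sum_range (N : ℕ) (c : ℕ → ℂ) (w : ℂ) :
    LSeries (fun k : ℕ => if 1 ≤ k ∧ k ≤ N then c (k - 1) else 0) w =
      ∑ m ∈ Finset.range N, c m * ((m : ℂ) + 1) ^ (-w) := by
  rw [LSeries, tsum_eq_sum (s := Finset.range (N + 1))]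
  · rw [Finset.sum_range_succ', term_zero, add_zero]
    refine Finset.sum_congr rfl fun m hm => ?_
    rw [Finset.mem_range] at hm
    have h1 : 1 ≤ m + 1 ∧ m + 1 ≤ N := ⟨by omega, by omega⟩
    simp only [term_of_ne_zero (Nat.succ_ne_zero m), h1, and_self, if_true, Nat.succ_sub_one,
      Nat.cast_succ, cpow_neg, div_eq_mul_inv]
  · intro k hk
    rw [Finset.mem_range, not_lt] at hk
    rcases Nat.eq_zero_or_pos k with rfl | hk0
    · exact term_zero _ _
    · rw [term_of_ne_zero hk0.ne', if_neg (by omega), zero_div]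

/-- **Uniqueness of Dirichlet coefficients on a disc** (`ℕ`-indexed coefficients).  If
`Σ_{m<N} c_m (m+1)^{-w} = 0` for every `w` in an open disc then `c_m = 0` for all `m < N`: the sum is
an entire function (a finitely supported `L`-series), so it vanishes identically (identity theorem),
and `L`-series coefficients are unique (Mathlib `LSeries_eq_zero_iff`). [folklore] -/
theorem eq_zero_of_sum_range_eq_zero_on_ball {N : ℕ} (c : ℕ → ℂ) {z₀ : ℂ} {r : ℝ} (hr : 0 < r)
    (h : ∀ w ∈ ball z₀ r, ∑ m ∈ Finset.range N, c m * ((m : ℂ) + 1) ^ (-w) = 0) :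
    ∀ m < N, c m = 0 := by
  set f : ℕ → ℂ := fun k => if 1 ≤ k ∧ k ≤ N then c (k - 1) else 0 with hfdef
  have hsupp : (Function.support f).Finite := by
    refine (Set.finite_Iic N).subset fun k hk => ?_
    rw [Function.mem_support] at hk
    by_contra hkN
    exact hk (if_neg fun hh => hkN (Set.mem_Iic.mpr hh.2))
  have hf0 : f 0 = 0 := if_neg (by omega)
  have hLf : ∀ w, LSeries f w = ∑ m ∈ Finset.range N, c m * ((m : ℂ) + 1) ^ (-w) :=
    fun w => LSeries_shift_eq_sum_range N c w
  -- `LSeries f` is entire and vanishes on the disc, hence everywhere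
  have hentire : AnalyticOnNhd ℂ (LSeries f) Set.univ :=
    analyticOnNhd_univ_iff_differentiable.mpr (FiniteLSeries.differentiable hsupp)
  have hev : LSeries f =ᶠ[𝓝 z₀] 0 :=
    Filter.eventually_of_mem (ball_mem_nhds z₀ hr) fun w hw => by
      rw [Pi.zero_apply, hLf w, h w hw]
  have hzero : LSeries f = 0 := by
    funext w
    exact hentire.eqOn_zero_of_preconnected_of_eventuallyEq_zero isPreconnected_univ
      (Set.mem_univ z₀) hev (Set.mem_univ w)
  have hf : f = 0 :=
    ((LSeries_eq_zero_iff hf0).mp hzero).resolve_right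
      ((FiniteLSeries.abscissaOfAbsConv_lt hsupp 0).trans_le le_top).ne
  intro m hm
  have h1 : 1 ≤ m + 1 ∧ m + 1 ≤ N := ⟨by omega, by omega⟩
  have := congr_fun hf (m + 1)
  simpa [hfdef, h1] using this

/-- **Uniqueness of Dirichlet coefficients on a disc** (`Fin N`-indexed, the shape of `E_NB`): if
`Σ_{n<N} b_n (n+1)^{-w} = 0` on an open disc then `b = 0`. [folklore] -/
theorem eq_zero_of_sum_eq_zero_on_ball {N : ℕ} (b : Fin N → ℂ) {z₀ : ℂ} {r : ℝ} (hr : 0 < r)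
    (h : ∀ w ∈ ball z₀ r, ∑ n : Fin N, b n * ((n : ℂ) + 1) ^ (-w) = 0) : b = 0 := by
  classical
  set c : ℕ → ℂ := fun m => if hm : m < N then b ⟨m, hm⟩ else 0 with hcdef
  have hc : ∀ w ∈ ball z₀ r, ∑ m ∈ Finset.range N, c m * ((m : ℂ) + 1) ^ (-w) = 0 := by
    intro w hw
    rw [← h w hw, ← Fin.sum_univ_eq_sum_range (fun m => c m * ((m : ℂ) + 1) ^ (-w)) N]
    refine Finset.sum_congr rfl fun n _ => ?_
    simp only [hcdef, dif_pos n.isLt]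
  funext n
  have := eq_zero_of_sum_range_eq_zero_on_ball c hr hc n n.isLt
  simpa [hcdef, dif_pos n.isLt] using this

/-- Vertical shifts act on Dirichlet monomials through unimodular phases:
`(n+1)^{-(s + iτ)} = (n+1)^{-iτ} · (n+1)^{-s}`. [folklore] -/
theorem cpow_neg_add_mul_I (n : ℕ) (s : ℂ) (τ : ℝ) :
    ((n : ℂ) + 1) ^ (-(s + τ * I)) = ((n : ℂ) + 1) ^ (-(τ * I)) * ((n : ℂ) + 1) ^ (-s) := by
  rw [← cpow_add _ _ (Nat.cast_add_one_ne_zero n)]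
  congr 1
  ring

/-- The phases are unimodular: `‖(n+1)^{-iτ}‖ = 1`. [folklore] -/
theorem norm_cpow_neg_mul_I (n : ℕ) (τ : ℝ) : ‖((n : ℂ) + 1) ^ (-(τ * I))‖ = 1 := by
  have h : ((n : ℂ) + 1) = ((n + 1 : ℕ) : ℂ) := by push_cast; ring
  rw [h, norm_natCast_cpow_of_pos (Nat.succ_pos n)]
  simp

/-- On `Re w ≥ 0` a Dirichlet monomial has modulus at most its coefficient:
`‖a (n+1)^{-w}‖ ≤ ‖a‖`. [folklore] -/
theorem norm_mul_cpow_neg_le (a : ℂ) (n : ℕ) {w : ℂ} (hw : 0 ≤ w.re) :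
    ‖a * ((n : ℂ) + 1) ^ (-w)‖ ≤ ‖a‖ := by
  have h : ((n : ℂ) + 1) = ((n + 1 : ℕ) : ℂ) := by push_cast; ring
  have h1 : ‖((n : ℂ) + 1) ^ (-w)‖ ≤ 1 := by
    rw [h, norm_natCast_cpow_of_pos (Nat.succ_pos n)]
    refine Real.rpow_le_one_of_one_le_of_nonpos ?_ ?_
    · exact_mod_cast Nat.succ_pos n
    · simpa using hw
  calc ‖a * ((n : ℂ) + 1) ^ (-w)‖ = ‖a‖ * ‖((n : ℂ) + 1) ^ (-w)‖ := norm_mul _ _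
    _ ≤ ‖a‖ * 1 := by gcongr
    _ = ‖a‖ := mul_one _

/-- **The disc floor (compactness of the torus).**  If `a ≠ 0` and `ρ > 0` there is `m > 0` such that
for EVERY unimodular twist `Θ` (`‖Θ_n‖ = 1`) the twisted polynomial `Σ_n a_n Θ_n (n+1)^{-s}` has modulus
`≥ m` at some point of the disc `|s - c| ≤ ρ`.  (Otherwise twists `Θ_k` with sup `< 1/(k+1)` accumulate
at a twist `Θ*` on the compact torus whose polynomial vanishes on the open disc, so `a_n Θ*_n = 0` for
all `n` by uniqueness of Dirichlet coefficients, i.e. `a = 0`.) [folklore] -/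
theorem exists_disc_floor {N : ℕ} {a : Fin N → ℂ} (ha : a ≠ 0) (c : ℂ) {ρ : ℝ} (hρ : 0 < ρ) :
    ∃ m : ℝ, 0 < m ∧ ∀ Θ : Fin N → ℂ, (∀ n, ‖Θ n‖ = 1) →
      ∃ s ∈ closedBall c ρ, m ≤ ‖∑ n : Fin N, a n * Θ n * ((n : ℂ) + 1) ^ (-s)‖ := by
  classical
  by_contra hcon
  push Not at hcon
  choose Θ hΘ1 hΘlt using fun k : ℕ => hcon (1 / ((k : ℝ) + 1)) (by positivity)
  have hK : IsCompact (Set.pi Set.univ fun _ : Fin N => sphere (0 : ℂ) 1) :=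
    isCompact_univ_pi fun _ => isCompact_sphere _ _
  have hmem : ∀ k, Θ k ∈ Set.pi Set.univ fun _ : Fin N => sphere (0 : ℂ) 1 :=
    fun k => Set.mem_univ_pi.mpr fun n => mem_sphere_zero_iff_norm.mpr (hΘ1 k n)
  obtain ⟨Θs, hΘs, φ, hφ, hlim⟩ := hK.tendsto_subseq hmem
  have hΘs1 : ∀ n, ‖Θs n‖ = 1 := fun n => mem_sphere_zero_iff_norm.mp (Set.mem_univ_pi.mp hΘs n)
  -- the limit polynomial vanishes on the open disc
  have hzero : ∀ w ∈ ball c ρ, ∑ n : Fin N, (a n * Θs n) * ((n : ℂ) + 1) ^ (-w) = 0 := by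
    intro w hw
    have hwmem : w ∈ closedBall c ρ := ball_subset_closedBall hw
    have hcont : Continuous fun Θ : Fin N → ℂ => ∑ n : Fin N, a n * Θ n * ((n : ℂ) + 1) ^ (-w) :=
      continuous_finsetSum _ fun n _ =>
        (continuous_const.mul (continuous_apply n)).mul continuous_const
    have h1 : Tendsto (fun k => ∑ n : Fin N, a n * Θ (φ k) n * ((n : ℂ) + 1) ^ (-w))
        atTop (𝓝 (∑ n : Fin N, a n * Θs n * ((n : ℂ) + 1) ^ (-w))) :=
      (hcont.tendsto Θs).comp hlim
    have h0 : Tendsto (fun k : ℕ => 1 / ((φ k : ℝ) + 1)) atTop (𝓝 0) :=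
      (tendsto_one_div_add_atTop_nhds_zero_nat (𝕜 := ℝ)).comp hφ.tendsto_atTop
    have h2 : Tendsto (fun k => ∑ n : Fin N, a n * Θ (φ k) n * ((n : ℂ) + 1) ^ (-w))
        atTop (𝓝 0) :=
      tendsto_zero_iff_norm_tendsto_zero.mpr
        (squeeze_zero (fun _ => norm_nonneg _) (fun k => (hΘlt (φ k) _ hwmem).le) h0)
    exact tendsto_nhds_unique h1 h2
  have hb := eq_zero_of_sum_eq_zero_on_ball (fun n => a n * Θs n) hρ hzero
  refine ha (funext fun n => ?_)
  have hΘne : Θs n ≠ 0 := by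
    intro h0
    have h1 := hΘs1 n
    rw [h0, norm_zero] at h1
    exact zero_ne_one h1
  exact (mul_eq_zero.mp (congr_fun hb n)).resolve_right hΘne

/-- **The window floor (nb/neg T43a; `ζ`-free, RH-free).**  A non-zero Dirichlet polynomial
`A(s) = Σ_{n<N} a_n (n+1)^{-s}` is not uniformly small on any far window: for every disc `|s - c| ≤ ρ`
there is `m > 0` with `max_{|s-(c+iτ)| ≤ ρ} |A(s)| ≥ m` for EVERY real `τ`.  (Disc floor applied to the
twist `Θ_n = (n+1)^{-iτ}`.) [folklore] -/
theorem exists_window_floor {N : ℕ} {a : Fin N → ℂ} (ha : a ≠ 0) (c : ℂ) {ρ : ℝ} (hρ : 0 < ρ) :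
    ∃ m : ℝ, 0 < m ∧ ∀ τ : ℝ, ∃ s ∈ closedBall (c + τ * I) ρ,
      m ≤ ‖∑ n : Fin N, a n * ((n : ℂ) + 1) ^ (-s)‖ := by
  obtain ⟨m, hm, hfloor⟩ := exists_disc_floor ha c hρ
  refine ⟨m, hm, fun τ => ?_⟩
  obtain ⟨s, hs, hms⟩ :=
    hfloor (fun n => ((n : ℂ) + 1) ^ (-(τ * I))) fun n => norm_cpow_neg_mul_I n τ
  refine ⟨s + τ * I, ?_, ?_⟩
  · rw [mem_closedBall, dist_eq_norm] at hs ⊢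
    have : s + τ * I - (c + τ * I) = s - c := by ring
    rw [this]
    exact hs
  · have hsum : ∑ n : Fin N, a n * ((n : ℂ) + 1) ^ (-(s + τ * I)) =
        ∑ n : Fin N, a n * ((n : ℂ) + 1) ^ (-(τ * I)) * ((n : ℂ) + 1) ^ (-s) :=
      Finset.sum_congr rfl fun n _ => by rw [cpow_neg_add_mul_I, mul_assoc]
    rw [hsum]
    exact hms

/-! ## §2 — Mollified universality (elementary route): `ζ·A` is confined to no annulus on any far sub-strip -/

/-- A point of the disc `|s - c| ≤ ρ` with real centre `c = (σ₁+σ₂)/2`, `ρ = (σ₂-σ₁)/2`, shifted by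
`iτ`, has `σ₁ ≤ Re ≤ σ₂` and `Im ≥ τ - ρ`. [folklore] -/
theorem strip_re_im_of_mem_closedBall {σ₁ σ₂ : ℝ} {s : ℂ}
    (hs : s ∈ closedBall ((((σ₁ + σ₂) / 2 : ℝ)) : ℂ) ((σ₂ - σ₁) / 2)) (τ : ℝ) :
    σ₁ ≤ (s + τ * I).re ∧ (s + τ * I).re ≤ σ₂ ∧ τ - (σ₂ - σ₁) / 2 ≤ (s + τ * I).im := by
  rw [mem_closedBall, dist_eq_norm] at hs
  have hre := (abs_re_le_norm (s - (((σ₁ + σ₂) / 2 : ℝ) : ℂ))).trans hs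
  have him := (abs_im_le_norm (s - (((σ₁ + σ₂) / 2 : ℝ) : ℂ))).trans hs
  rw [sub_re, ofReal_re] at hre
  rw [sub_im, ofReal_im, sub_zero] at him
  have h1 : (s + τ * I).re = s.re := by simp
  have h2 : (s + τ * I).im = s.im + τ := by simp
  rw [h1, h2]
  refine ⟨?_, ?_, ?_⟩
  · linarith [(abs_le.mp hre).1]
  · linarith [(abs_le.mp hre).2]
  · linarith [(abs_le.mp him).1]

/-- **Mollified universality, large values (nb/neg T43b; RH-free).**  For `1/2 < σ₁ < σ₂ < 1`, every
NON-ZERO Dirichlet polynomial `A(s) = Σ_{n<N} a_n (n+1)^{-s}`, every `R` and every height `T₀` there is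
`s` with `σ₁ ≤ Re s ≤ σ₂`, `Im s ≥ T₀` and `‖ζ(s)·A(s)‖ > R`.  The disc universality theorem (tree,
`Steuding2007_thm1_9_discAnalytic_holds`; Voronin 1975) with the constant target `2K`, `K = max(R,1)/m`,
tolerance `K`, on the disc of centre `(σ₁+σ₂)/2` and radius `(σ₂-σ₁)/2` makes `|ζ| > K` on a whole far
translate of the disc, on which the window floor gives a point with `|A| ≥ m`.
[cite: Steuding2007, Thm. 1.9] -/
theorem exists_lt_norm_zeta_mul {N : ℕ} {a : Fin N → ℂ} (ha : a ≠ 0) {σ₁ σ₂ : ℝ} (h₁ : 1 / 2 < σ₁)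
    (h₁₂ : σ₁ < σ₂) (h₂ : σ₂ < 1) (R T₀ : ℝ) :
    ∃ s : ℂ, σ₁ ≤ s.re ∧ s.re ≤ σ₂ ∧ T₀ ≤ s.im ∧
      R < ‖riemannZeta s * ∑ n : Fin N, a n * ((n : ℂ) + 1) ^ (-s)‖ := by
  set c : ℂ := (((σ₁ + σ₂) / 2 : ℝ) : ℂ) with hc
  set ρ : ℝ := (σ₂ - σ₁) / 2 with hρ
  have hρpos : 0 < ρ := by rw [hρ]; linarith
  have hcre : c.re = (σ₁ + σ₂) / 2 := by rw [hc, ofReal_re]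
  obtain ⟨m, hm, hfloor⟩ := exists_disc_floor ha c hρpos
  set R' : ℝ := max R 1 with hR'
  have hR'1 : 1 ≤ R' := le_max_right _ _
  set K : ℝ := R' / m with hK
  have hKpos : 0 < K := by positivity
  have hgpos : 0 < 2 * K := by positivity
  have hg0 : ((2 * K : ℝ) : ℂ) ≠ 0 := ofReal_ne_zero.mpr hgpos.ne'
  have hA : HasPosLowerDensity
      {τ : ℝ | ∀ s ∈ closedBall c ρ, ‖riemannZeta (s + τ * I) - ((2 * K : ℝ) : ℂ)‖ < K} :=
    Steuding2007_thm1_9_discAnalytic_holds c ρ (2 * ρ) hρpos (by linarith)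
      (by rw [hcre, hρ]; linarith) (by rw [hcre, hρ]; linarith)
      (fun _ => ((2 * K : ℝ) : ℂ)) (differentiableOn_const _) (fun _ _ => hg0) K hKpos
  obtain ⟨τ, hτ, hτT⟩ := hA.exists_gt (|T₀| + ρ)
  obtain ⟨s, hs, hms⟩ :=
    hfloor (fun n => ((n : ℂ) + 1) ^ (-(τ * I))) fun n => norm_cpow_neg_mul_I n τ
  obtain ⟨hre₁, hre₂, him⟩ := strip_re_im_of_mem_closedBall hs τ
  refine ⟨s + τ * I, hre₁, hre₂, by linarith [le_abs_self T₀], ?_⟩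
  have hlt : ‖riemannZeta (s + τ * I) - ((2 * K : ℝ) : ℂ)‖ < K := hτ s hs
  have hg : ‖((2 * K : ℝ) : ℂ)‖ = 2 * K := by
    rw [Complex.norm_real, Real.norm_eq_abs, abs_of_pos hgpos]
  have htri : ‖((2 * K : ℝ) : ℂ)‖ - ‖riemannZeta (s + τ * I)‖ ≤
      ‖riemannZeta (s + τ * I) - ((2 * K : ℝ) : ℂ)‖ := by
    rw [norm_sub_rev]
    exact norm_sub_norm_le _ _
  rw [hg] at htri
  have hζ : K < ‖riemannZeta (s + τ * I)‖ := by linarith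
  have hsum : ∑ n : Fin N, a n * ((n : ℂ) + 1) ^ (-(s + τ * I)) =
      ∑ n : Fin N, a n * ((n : ℂ) + 1) ^ (-(τ * I)) * ((n : ℂ) + 1) ^ (-s) :=
    Finset.sum_congr rfl fun n _ => by rw [cpow_neg_add_mul_I, mul_assoc]
  rw [norm_mul, hsum]
  calc R ≤ R' := le_max_left _ _
    _ = K * m := by rw [hK]; field_simp
    _ < ‖riemannZeta (s + τ * I)‖ * m := mul_lt_mul_of_pos_right hζ hm
    _ ≤ ‖riemannZeta (s + τ * I)‖ *
          ‖∑ n : Fin N, a n * ((n : ℂ) + 1) ^ (-(τ * I)) * ((n : ℂ) + 1) ^ (-s)‖ :=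
      mul_le_mul_of_nonneg_left hms (norm_nonneg _)

/-- **Mollified universality, small values (nb/neg T43c; RH-free).**  For `1/2 < σ₁ < σ₂ < 1`, EVERY
Dirichlet polynomial `A`, every `δ > 0` and every `T₀` there is `s` with `σ₁ ≤ Re s ≤ σ₂`, `Im s ≥ T₀`
and `‖ζ(s)·A(s)‖ < δ` (disc universality with the small constant target `η = δ/(2(Σ|a_n|+1))`, read at
the centre of the disc, and `|A| ≤ Σ|a_n|` on `Re s ≥ 0`).  With T43b: on every far part of every closed
sub-strip, `ζ·A` is confined to NO annulus `δ ≤ |z| ≤ R`. [cite: Steuding2007, Thm. 1.9] -/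
theorem exists_norm_zeta_mul_lt {N : ℕ} (a : Fin N → ℂ) {σ₁ σ₂ : ℝ} (h₁ : 1 / 2 < σ₁)
    (h₁₂ : σ₁ < σ₂) (h₂ : σ₂ < 1) {δ : ℝ} (hδ : 0 < δ) (T₀ : ℝ) :
    ∃ s : ℂ, σ₁ ≤ s.re ∧ s.re ≤ σ₂ ∧ T₀ ≤ s.im ∧
      ‖riemannZeta s * ∑ n : Fin N, a n * ((n : ℂ) + 1) ^ (-s)‖ < δ := by
  set c : ℂ := (((σ₁ + σ₂) / 2 : ℝ) : ℂ) with hc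
  set ρ : ℝ := (σ₂ - σ₁) / 2 with hρ
  have hρpos : 0 < ρ := by rw [hρ]; linarith
  have hcre : c.re = (σ₁ + σ₂) / 2 := by rw [hc, ofReal_re]
  set S : ℝ := ∑ n : Fin N, ‖a n‖ with hS
  have hS0 : 0 ≤ S := Finset.sum_nonneg fun n _ => norm_nonneg _
  set η : ℝ := δ / (2 * (S + 1)) with hη
  have hηpos : 0 < η := by positivity
  have hg0 : ((η : ℝ) : ℂ) ≠ 0 := ofReal_ne_zero.mpr hηpos.ne'
  have hA : HasPosLowerDensity
      {τ : ℝ | ∀ s ∈ closedBall c ρ, ‖riemannZeta (s + τ * I) - (η : ℂ)‖ < η} :=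
    Steuding2007_thm1_9_discAnalytic_holds c ρ (2 * ρ) hρpos (by linarith)
      (by rw [hcre, hρ]; linarith) (by rw [hcre, hρ]; linarith)
      (fun _ => (η : ℂ)) (differentiableOn_const _) (fun _ _ => hg0) η hηpos
  obtain ⟨τ, hτ, hτT⟩ := hA.exists_gt (|T₀| + ρ)
  have hcmem : c ∈ closedBall c ρ := mem_closedBall_self hρpos.le
  obtain ⟨hre₁, hre₂, him⟩ := strip_re_im_of_mem_closedBall hcmem τ
  refine ⟨c + τ * I, hre₁, hre₂, by linarith [le_abs_self T₀], ?_⟩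
  have hlt : ‖riemannZeta (c + τ * I) - (η : ℂ)‖ < η := hτ c hcmem
  have hn : ‖(η : ℂ)‖ = η := by rw [Complex.norm_real, Real.norm_eq_abs, abs_of_pos hηpos]
  have h3 : ‖riemannZeta (c + τ * I)‖ ≤ ‖riemannZeta (c + τ * I) - (η : ℂ)‖ + ‖(η : ℂ)‖ := by
    simpa only [sub_add_cancel] using norm_add_le (riemannZeta (c + τ * I) - (η : ℂ)) (η : ℂ)
  rw [hn] at h3
  have hζ : ‖riemannZeta (c + τ * I)‖ < 2 * η := by linarith
  have hre : 0 ≤ (c + τ * I).re := by linarith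
  have hAle : ‖∑ n : Fin N, a n * ((n : ℂ) + 1) ^ (-(c + τ * I))‖ ≤ S :=
    (norm_sum_le _ _).trans (Finset.sum_le_sum fun n _ => norm_mul_cpow_neg_le (a n) n hre)
  rw [norm_mul]
  have hkey : 2 * η * S < δ := by
    have hSS : 2 * η * S = δ * S / (S + 1) := by
      rw [hη]
      field_simp
    rw [hSS, div_lt_iff₀ (by positivity)]
    nlinarith
  calc ‖riemannZeta (c + τ * I)‖ * ‖∑ n : Fin N, a n * ((n : ℂ) + 1) ^ (-(c + τ * I))‖
      ≤ 2 * η * S := mul_le_mul hζ.le hAle (norm_nonneg _) (by positivity)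
    _ < δ := hkey

/-- **The Nyman–Beurling defect `1 - ζA` is UNBOUNDED on every far part of every closed sub-strip
(nb/neg T43b′; RH-free).**  For `1/2 < σ₁ < σ₂ < 1`, `a ≠ 0`, every `C` and `T₀` there is `s` with
`σ₁ ≤ Re s ≤ σ₂`, `Im s ≥ T₀` and `‖1 - ζ(s)·A(s)‖ > C`. [cite: Steuding2007, Thm. 1.9] -/
theorem exists_lt_norm_one_sub_zeta_mul {N : ℕ} {a : Fin N → ℂ} (ha : a ≠ 0) {σ₁ σ₂ : ℝ}
    (h₁ : 1 / 2 < σ₁) (h₁₂ : σ₁ < σ₂) (h₂ : σ₂ < 1) (C T₀ : ℝ) :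
    ∃ s : ℂ, σ₁ ≤ s.re ∧ s.re ≤ σ₂ ∧ T₀ ≤ s.im ∧
      C < ‖1 - riemannZeta s * ∑ n : Fin N, a n * ((n : ℂ) + 1) ^ (-s)‖ := by
  obtain ⟨s, hs₁, hs₂, hs₃, h3⟩ := exists_lt_norm_zeta_mul ha h₁ h₁₂ h₂ (|C| + 1) T₀
  refine ⟨s, hs₁, hs₂, hs₃, ?_⟩
  have h4 : ‖riemannZeta s * ∑ n : Fin N, a n * ((n : ℂ) + 1) ^ (-s)‖ ≤
      ‖(1 : ℂ)‖ + ‖1 - riemannZeta s * ∑ n : Fin N, a n * ((n : ℂ) + 1) ^ (-s)‖ := by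
    simpa only [sub_sub_cancel] using
      norm_sub_le (1 : ℂ) (1 - riemannZeta s * ∑ n : Fin N, a n * ((n : ℂ) + 1) ^ (-s))
  rw [norm_one] at h4
  linarith [le_abs_self C]


end Summit.RiemannHypothesis.RiemannHypothesis.Theorems.Splittings.NbOneShot

end
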